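/-
Copyright (c) 2026. All rights reserved.
Released under Apache 2.0 license as described in the file LICENSE.
Authors: abc-iut cell, prover seat abc-iut-w5-d144 (gen 6; row «COR510iv-SB′», brick D1), over this seat's
`DiagramChainFamiliesTwoSided.lean` and abc-iut-L4-t5 / abc-iut-f-101's `DiagramOverHomotopies.lean`.
-/
import Literature.AnabelianGeometry.AbsoluteAnabelian.DiagramChainFamiliesTwoSided
import Literature.AnabelianGeometry.AbsoluteAnabelian.DiagramOverHomotopies

/-!
# Two-sided generated families of OVER-homotopies: coherence at faithful vertices ([AbsTopIII] Def. 3.5 (ii), Rmk 3.5.1, toolkit)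

S. Mochizuki, *Topics in Absolute Anabelian Geometry III*, Def. 3.5 (ii) p. 75 (families of homotopies), Rmk 3.5.1
p. 78 («a core as a sort of 'constant portion' of the diagram that lies, in a consistent fashion, 'under the entire
diagram'»), kurims manuscript `paper:url-5493eb38cbb7`, bib key `MochizukiAbsTopIII2015`.

The COHERENCE hypothesis `thin` of `chainFamily₂` (`DiagramChainFamiliesTwoSided.lean`: the family generated by two-sided
whiskered generator pairs) at the vertices of an OVER-diagram (`OverData`: structure functors `N_v : 𝒟_v ⥤ 𝒞` with
`μ_e : 𝒟_e ⋙ N ≅ N`) whose structure functor is FAITHFUL: if every generator homotopy lies over the structure functors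
(`OverData.IsOver`), then so does the homotopy of every two-sided move and of every chain (over-ness is stable under
composition and two-sided whiskering — abc-iut-f-101's `IsOver.comp` / `IsOver.whisker`), hence any two chains between the
same pair of paths into a vertex with FAITHFUL structure functor have the same homotopy (`IsOver.eq_of_faithful`), which
is THE lift when the structure functor is fully faithful (`IsOver.eq_lift`).  In particular on an over-diagram ALL of whose
structure functors are faithful, every system of over-generators is coherent and generates ONE family of homotopies
containing all of them (`overChainFamily₂`) — the over-analogue of the universal family of abc-iut-L4-t5.

Consumer: the compatibility closer of [AbsTopIII] Cor 5.10 (iv)(b) (row «COR510iv-SB′», spec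
`COR510iv-SBprime-CLOSER-SPEC.md` §6, class (M1): pairs of paths through the core vertex `An⊢[𝒩⊢⊞]`, whose structure functor
`An⊢ ⥲ ℰ⊢` is an equivalence).  Pure category theory; nothing here bears on [IUTchIII] Cor. 3.12.

* `OverData.isOver_moveHom₂` — a two-sided whiskered over-homotopy is over;
* `Move₂.isOver_hom`, `Chain₂.isOver_hom` — moves and chains of over-generators are over;
* `Chain₂.hom_eq_of_faithful` — **thinness at a faithful vertex**; `Chain₂.hom_eq_lift` — the common value is the lift at a
  fully faithful vertex;
* `thin_of_forall_faithful`, `overChainFamily₂`, `overChainFamily₂_η_move`, `overChainFamily₂_isOver` — all structure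
  functors faithful ⇒ the generated family exists, contains every move, and consists of over-homotopies;
* (appended) the ONE-SIDED case of abc-iut-f-101's `chainFamily` (sink vertex): `OverData.isOver_moveHom`,
  `Move.isOver_hom`, `Chain.isOver_hom`, ★ `isOver_chainFamily_η` (generators over ⇒ every homotopy of the generated
  observable family over), `Chain.hom_eq_of_faithful`.
-/

namespace Literature.AnabelianGeometry.AbsoluteAnabelian

open _root_.CategoryTheory _root_.Quiver

universe t v u w

namespace DiagramOfCategories

variable {V : Type w} [Quiver.{v} V] {D : DiagramOfCategories.{v, u, w} V} {C : Type u} [Category.{v} C]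
  (O : D.OverData C)

namespace OverData

/-- **A two-sided whiskered over-homotopy is over**: if `α : 𝒟_[g] ⟶ 𝒟_[g']` lies over the structure functors, so
does `moveHom₂ r α t : 𝒟_[r ; g ; t] ⟶ 𝒟_[r ; g' ; t]` (abc-iut-f-101's `IsOver.whisker`, re-indexed along the path
equations). [cite: MochizukiAbsTopIII2015, Definition 3.5 (ii) p.75] -/
theorem isOver_moveHom₂ {a c d b : V} (r : Path a c) {g g' : Path c d} {α : D.pathFunctor g ⟶ D.pathFunctor g'}
    (hα : O.IsOver g g' α) (t : Path d b) {p p' : Path a b} (hp : p = (r.comp g).comp t)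
    (hp' : p' = (r.comp g').comp t) : O.IsOver p p' (D.moveHom₂ r α t hp hp') := by
  have h := (hα.whisker r t).congr (show r.comp (g.comp t) = p by rw [hp, Path.comp_assoc])
    (show r.comp (g'.comp t) = p' by rw [hp', Path.comp_assoc])
  convert h using 1
  simp only [moveHom₂, Category.assoc, eqToHom_trans, eqToHom_trans_assoc]

end OverData

variable (Gen : ∀ ⦃c d : V⦄, Path c d → Path c d → Type t)
  (genHom : ∀ ⦃c d : V⦄ ⦃g g' : Path c d⦄, Gen g g' → (D.pathFunctor g ⟶ D.pathFunctor g'))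
  (hgen : ∀ ⦃c d : V⦄ ⦃g g' : Path c d⦄ (s : Gen g g'), O.IsOver g g' (genHom s))

include hgen

/-- **Moves of over-generators are over.** [cite: MochizukiAbsTopIII2015, Definition 3.5 (ii) p.75] -/
theorem Move₂.isOver_hom {a b : V} {p p' : Path a b} (m : Move₂ Gen p p') : O.IsOver p p' (m.hom genHom) :=
  O.isOver_moveHom₂ m.r (hgen m.s) m.t m.hp m.hp'

/-- **Chains of over-moves are over** (over-ness is closed under composition, abc-iut-f-101's `IsOver.comp`).
[cite: MochizukiAbsTopIII2015, Definition 3.5 (ii) p.75] -/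
theorem Chain₂.isOver_hom : ∀ {a b : V} {p q : Path a b} (c : Chain₂ Gen p q), O.IsOver p q (c.hom genHom)
  | _, _, _, _, Chain₂.nil p => by
    rw [Chain₂.hom]
    exact O.isOver_id p
  | _, _, _, _, Chain₂.cons m rest => by
    rw [Chain₂.hom_cons]
    exact (Move₂.isOver_hom O Gen genHom hgen m).comp (Chain₂.isOver_hom rest)

/-- ★ **Thinness at a FAITHFUL vertex**: any two chains of over-moves between the same pair of paths into a vertex whose
structure functor is faithful have the same homotopy (abc-iut-f-101's `IsOver.eq_of_faithful`; Rmk 3.5.1: over a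
faithful vertex a homotopy is determined by its image in the base). [cite: MochizukiAbsTopIII2015, Remark 3.5.1 p.78] -/
theorem Chain₂.hom_eq_of_faithful {a b : V} [(O.N b).Faithful] {p q : Path a b} (c c' : Chain₂ Gen p q) :
    c.hom genHom = c'.hom genHom :=
  (Chain₂.isOver_hom O Gen genHom hgen c).eq_of_faithful (Chain₂.isOver_hom O Gen genHom hgen c')

/-- At a FULLY FAITHFUL vertex the homotopy of every chain of over-moves is THE lift of abc-iut-L4-t5
(`OverData.lift`). [cite: MochizukiAbsTopIII2015, Remark 3.5.1 p.78] -/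
theorem Chain₂.hom_eq_lift {a w : V} (hw : (O.N w).FullyFaithful) {p q : Path a w} (c : Chain₂ Gen p q) :
    c.hom genHom = O.lift hw p q :=
  (Chain₂.isOver_hom O Gen genHom hgen c).eq_lift hw

/-! ## All structure functors faithful: over-generators are coherent -/

/-- **Coherence from faithfulness**: on an over-diagram ALL of whose structure functors are faithful, every system of
over-generators satisfies the coherence hypothesis `thin` of `chainFamily₂`.
[cite: MochizukiAbsTopIII2015, Remark 3.5.1 p.78] -/
theorem thin_of_forall_faithful (hN : ∀ b : V, (O.N b).Faithful) {a b : V} (p q : Path a b)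
    (c c' : Chain₂ Gen p q) : c.hom genHom = c'.hom genHom :=
  haveI := hN b
  Chain₂.hom_eq_of_faithful O Gen genHom hgen c c'

/-- ★ **The family generated by over-generators on an everywhere-faithful over-diagram** (Def. 3.5 (ii)): ONE family of
homotopies whose boundary set is «pairs joined by a chain of two-sided moves» and which carries every generator's
homotopy — so any collection of sub-systems of over-generators is COMPATIBLE in the sense of Def. 3.5 (ii).
[cite: MochizukiAbsTopIII2015, Definition 3.5 (ii) p.75] -/
noncomputable def overChainFamily₂ (hN : ∀ b : V, (O.N b).Faithful) : D.HomotopyFamily :=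
  chainFamily₂ D Gen genHom (fun p q c c' => thin_of_forall_faithful O Gen genHom hgen hN p q c c')

/-- Every two-sided move of the generators is a boundary pair of `overChainFamily₂` with its own homotopy.
[cite: MochizukiAbsTopIII2015, Definition 3.5 (ii) p.75] -/
theorem overChainFamily₂_η_move (hN : ∀ b : V, (O.N b).Faithful) {a b : V} {p p' : Path a b} (m : Move₂ Gen p p') :
    ∃ h : (overChainFamily₂ O Gen genHom hgen hN).E p p',
      (overChainFamily₂ O Gen genHom hgen hN).η h = m.hom genHom :=
  chainFamily₂_η_move D Gen genHom _ m

/-- Every homotopy of `overChainFamily₂` lies over the structure functors. [cite: MochizukiAbsTopIII2015, Remark 3.5.1 p.78] -/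
theorem overChainFamily₂_isOver (hN : ∀ b : V, (O.N b).Faithful) {a b : V} {p q : Path a b}
    (h : (overChainFamily₂ O Gen genHom hgen hN).E p q) :
    O.IsOver p q ((overChainFamily₂ O Gen genHom hgen hN).η h) := by
  obtain ⟨c⟩ := h
  rw [show (overChainFamily₂ O Gen genHom hgen hN).η ⟨c⟩ = c.hom genHom from chainFamily₂_η D Gen genHom _ _ c]
  exact Chain₂.isOver_hom O Gen genHom hgen c

/-! ## Appended (abc-iut-w5-d144 gen 6, same evening): the ONE-SIDED case (abc-iut-f-101's `chainFamily` into a sink vertex) -/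

omit hgen in
/-- **A one-sided whiskered over-homotopy is over**: abc-iut-f-101's `moveHom r α` (left whisker only, for generator pairs
into a sink vertex — the observables `S_log⊞_v`, `S_log_v`) of an over `α` is over (`IsOver.whiskerLeft`, re-indexed).
[cite: MochizukiAbsTopIII2015, Definition 3.5 (ii) p.75] -/
theorem OverData.isOver_moveHom {a c b : V} (r : Path a c) {g g' : Path c b} {α : D.pathFunctor g ⟶ D.pathFunctor g'}
    (hα : O.IsOver g g' α) {p p' : Path a b} (hp : p = r.comp g) (hp' : p' = r.comp g') :
    O.IsOver p p' (D.moveHom r α hp hp') := by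
  have h := (hα.whiskerLeft r).congr hp.symm hp'.symm
  convert h using 1
  simp only [moveHom, Category.assoc, eqToHom_trans, eqToHom_trans_assoc]

/-- One-sided moves of over-generators are over. [cite: MochizukiAbsTopIII2015, Definition 3.5 (ii) p.75] -/
theorem Move.isOver_hom {a b : V} {p p' : Path a b} (m : Move Gen p p') : O.IsOver p p' (m.hom genHom) :=
  O.isOver_moveHom m.r (hgen m.s) m.hp m.hp'

/-- One-sided chains of over-moves are over. [cite: MochizukiAbsTopIII2015, Definition 3.5 (ii) p.75] -/
theorem Chain.isOver_hom : ∀ {a b : V} {p q : Path a b} (c : Chain Gen p q), O.IsOver p q (c.hom genHom)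
  | _, _, _, _, Chain.nil p => by
    rw [Chain.hom_nil]
    exact O.isOver_id p
  | _, _, _, _, Chain.cons m rest => by
    rw [Chain.hom_cons]
    exact (Move.isOver_hom O Gen genHom hgen m).comp (Chain.isOver_hom rest)

/-- ★ **Every homotopy of a generated observable family lies over the structure functors** when its generators do: for
abc-iut-f-101's `chainFamily D Gen genHom ω hout thin` (the constructor of `S_log⊞_v` — `logObsFamily` — and of its `TS`
twin), `IsOver` on the generator pairs propagates to EVERY boundary pair (the hypothesis «all observable homotopies over
`Th•[Z]`» of the Cor 5.10 (iv)(b) compatibility closer, reduced to abc-iut-L4-t3's `IotaOver` on the generators).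
[cite: MochizukiAbsTopIII2015, Remark 3.5.1 p.78] -/
theorem isOver_chainFamily_η (ω : V) (hout : ∀ b : V, IsEmpty (ω ⟶ b))
    (thin : ∀ {a : V} (p q : Path a ω) (c c' : Chain Gen p q), c.hom genHom = c'.hom genHom)
    {a b : V} {p q : Path a b} (h : (chainFamily D Gen genHom ω hout thin).E p q) :
    O.IsOver p q ((chainFamily D Gen genHom ω hout thin).η h) := by
  obtain ⟨hb, ⟨c⟩⟩ := h
  subst hb
  rw [chainFamily_η D Gen genHom _ hout thin _ c]
  exact Chain.isOver_hom O Gen genHom hgen c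

/-- At a FAITHFUL sink vertex the generated observable family is automatically coherent: abc-iut-f-101's hypothesis `thin`
of `chainFamily` HOLDS for over-generators (so, over a faithful observation vertex, commuting-square conditions such as
`IotaSquaresCommute` are consequences of over-ness). [cite: MochizukiAbsTopIII2015, Remark 3.5.1 p.78] -/
theorem Chain.hom_eq_of_faithful {a b : V} [(O.N b).Faithful] {p q : Path a b} (c c' : Chain Gen p q) :
    c.hom genHom = c'.hom genHom :=
  (Chain.isOver_hom O Gen genHom hgen c).eq_of_faithful (Chain.isOver_hom O Gen genHom hgen c')

end DiagramOfCategories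

end Literature.AnabelianGeometry.AbsoluteAnabelian
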